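import Literature.NumberTheory.EllipticCurves.BurungaleSkinner2023.RationalThreeTorsionEngineProofs
import HarnessLib

/-!
# Burungale–Skinner 2023, Example (E2): `20.a3` at `p = 3` with `ℓ₀ = 2 ∈ A`, and its `−19` twist
# (every hypothesis of Thm. 2.8 KERNEL-CHECKED; conclusions modulo Thm. 2.8 / 2.9 / 3.1 / 3.2 / 3.5)

A. Burungale, C. Skinner, Proc. AMS Ser. B 10 (2023), p. 22, Example (E2), verbatim: "Consider the
curve 20.a3, which has minimal Weierstrass equation `E : y² = x³ + x² − x`. This curve has a rational
`3`-torsion point and satisfies the conditions of Theorem 2.8. In particular, `ϕ = 1`, `S = ∅`,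
`N = {5}`, and `A = {2}`. As `r₂ = 1`, we may take `ℓ₀ = 2`. By [18] there exists a positive proportion
of odd quadratic characters `ψ` satisfying `ψ(2) = ±1`, `ψ(5) = 1` or `ψ` is ramified at `5`,
`ψ(3) = −1`, `3 ∤ h_{K_ψ}`. For all such `ψ`, the twists `E^ψ` satisfy the conclusion of Theorem 2.8.
In particular, they hold for the `−19`-twist of `E` (the curve 7220.f3)."

The predecessor seat recorded (E2) as blocked ("additive at `2`: no tree lemma for additive conductor
exponents"). It is not: Thm. 2.8 only uses the SUPPORT of `N` (`3 ∤ N`, `2 ∣ N`), which the engine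
`RationalThreeTorsionEngineProofs` reads off `Δ = 2⁴·5` of the printed minimal model; the exponent
`f₂ = 2` (`N = 20`) is never needed. This file certifies, for `E = 20.a3 = [0,1,0,−1,0]`:

* §1 the model: `Δ = 80 = 2⁴·5`, `c₄ = 64 = 2⁶`; globally minimal (`|Δ| < 2¹²`); ADDITIVE at `2`
  (`2 ∣ Δ`, `2 ∣ c₄`: not multiplicative — "`A = {2}`"), multiplicative and NON-split at `5` (node
  quadratic `4X² + 2` rootless over `𝔽₅` — "`N = {5}`"), good elsewhere ("`S = ∅`"); the rational
  `3`-torsion point `T = (1, 1)` (`T + T = −T`);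
* §2 Thms. 2.9 / 3.2 / 3.5 for `20.a3` (`ℓ₀ = 2 ∈ A`, `2 ≡ −1 (mod 3)`, `r₂ = 1`), modulo the named
  facts: `posProportion_twists_c20a3`, `infinitelyMany_twists_c20a3(_pPartBSD)`,
  `infinitelyMany_evenTwists_c20a3_pPartBSD_rankZero`;
* §3 **ALL hypotheses of Thm. 2.8 for `(20.a3, Φ = ⟨T̄⟩, ℓ₀ = 2, K = K' = ℚ(√−19))`**
  (`thm28Hypotheses_c20a3_of_discr_eq_neg_nineteen`): (a) `ℓ₀ = 2 ∈ A`, `ψ(2) = ±1` (`2 ∤ 19`);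
  (c) `5 ∈ N`, `ψ(5) = +1` (`(−19/5) = 1`); (b), (d), (e) vacuous; (f) `ψ(3) = −1` (`(−19/3) = −1`);
  (g) `h(−19) = 1`; whence `twistConclusion_c20a3_neg_nineteen` — "they hold for the `−19`-twist of
  `E`": `rank E^{(−19)}(ℚ) = ord_{s=1} L(E^{(−19)}, s) = 1`, `λ = 1`, NON-DEGENERATE `3`-adic height
  on every global minimal model of `E^{(−19)}` (the curve `7220.f3`) — MODULO Thm. 2.8 by name
  (`thm28_twist_rankOne_nondegenerate`); and `pPartBSD_twist_c20a3_neg_nineteen` modulo Thm. 3.1.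
  The typed bundle `Thm28Hypotheses` is thus inhabited with `ℓ₀ ∈ A` (the additive branch).

Definitions with bodies (model, point) + theorems; no new facts.

References: [BurungaleSkinner2023] Example (E2) (p. 22), Thms. 2.8/2.9 (pp. 20–21), 3.1/3.2 (p. 25),
3.5 (p. 27); [SilvermanAEC2009] VII.1 Rem. 1.1, VII.5 Prop. 5.1; [Marcus2018] Ch. 3 Thm. 25, Ch. 5;
[Cox2013] §5.B.
-/

noncomputable section

open scoped Classical

open NumberField IsDedekindDomain IsDedekindDomain.HeightOneSpectrum WeierstrassCurve Polynomial
  Literature.NumberTheory.EllipticCurves Literature.NumberTheory.EllipticCurves.Rank1Residual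
  Literature.NumberTheory.QuadraticFields.Quadratic

namespace Literature.NumberTheory.EllipticCurves.BurungaleSkinner2023

/-! ### §1 The curve `20.a3 : y² = x³ + x² − x` -/

section Curve

/-- `20.a3 = [0,1,0,−1,0]` (`y² = x³ + x² − x`), the printed minimal Weierstrass equation, as an
integer model. [cite: BurungaleSkinner2023, Example (E2) (p. 22)] -/
abbrev M20a3 : WeierstrassCurve ℤ := ⟨0, 1, 0, -1, 0⟩

/-- `20.a3 / ℚ`. [cite: BurungaleSkinner2023, Example (E2) (p. 22)] -/
abbrev c20a3 : WeierstrassCurve ℚ := M20a3.baseChange ℚ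

/-- `Δ(20.a3) = 80 = 2⁴·5`. [cite: BurungaleSkinner2023, Example (E2) (p. 22)] -/
theorem M20a3_Δ : M20a3.Δ = 80 := by decide

/-- `c₄(20.a3) = 64 = 2⁶`. [cite: BurungaleSkinner2023, Example (E2) (p. 22)] -/
theorem M20a3_c₄ : M20a3.c₄ = 64 := by decide

/-- `20.a3` is an elliptic curve. [cite: BurungaleSkinner2023, Example (E2) (p. 22)] -/
theorem isElliptic_c20a3 : c20a3.IsElliptic := by
  rw [WeierstrassCurve.isElliptic_iff, baseChange_int_Δ, M20a3_Δ]; norm_num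

/-- The printed equation of `20.a3` is a global minimal equation (`|Δ| = 80 < 2¹²`), as the source
says ("minimal Weierstrass equation"). [cite: BurungaleSkinner2023, Example (E2) (p. 22)] [cite: SilvermanAEC2009, VII.1 Remark 1.1] -/
theorem isGloballyMinimal_c20a3 : c20a3.IsGloballyMinimal :=
  isGloballyMinimal_baseChange_int M20a3 (forall_not_pow_dvd_or_of_bound M20a3 (B := 2)
    (by rw [M20a3_Δ]; decide) (by rw [M20a3_Δ]; decide) (by rw [M20a3_Δ, M20a3_c₄]; decide))

/-- **"`A = {2}`": `20.a3` is NOT multiplicative at `2`** (additive: `2 ∣ Δ`, `2 ∣ c₄` on a minimal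
equation). [cite: BurungaleSkinner2023, Example (E2) (p. 22) ("A = {2}")] -/
theorem not_hasMultiplicativeReductionAtPrime_c20a3_two :
    ¬ c20a3.HasMultiplicativeReductionAtPrime 2 := by
  haveI := isElliptic_c20a3
  exact not_hasMultiplicativeReductionAtPrime_baseChange_int_of_dvd_of_dvd M20a3
    (by rw [M20a3_Δ]; decide) (by rw [M20a3_c₄]; decide)

/-- `20.a3` is multiplicative at `5` (`5 ∣ Δ`, `5 ∤ c₄`). [cite: SilvermanAEC2009, VII.5 Prop. 5.1(b)] -/
theorem hasMultiplicativeReductionAtPrime_c20a3_five [Fact (Nat.Prime 5)] :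
    c20a3.HasMultiplicativeReductionAtPrime 5 := by
  haveI := isElliptic_c20a3
  exact hasMultiplicativeReductionAtPrime_baseChange_int_of_dvd_of_not_dvd M20a3
    (by rw [M20a3_Δ]; decide) (by rw [M20a3_c₄]; decide)

/-- **"`S = ∅`", part 1: `20.a3` has good reduction at every prime `ℓ ∉ {2, 5}`.**
[cite: BurungaleSkinner2023, Example (E2) (p. 22) ("S = ∅, N = {5}, A = {2}")] -/
theorem hasGoodReductionAtPrime_c20a3 {ℓ : ℕ} [hℓ : Fact ℓ.Prime] (h2 : ℓ ≠ 2) (h5 : ℓ ≠ 5) :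
    c20a3.HasGoodReductionAtPrime ℓ := by
  haveI := isElliptic_c20a3
  refine hasGoodReductionAtPrime_baseChange_int_of_not_dvd M20a3 ?_
  rw [M20a3_Δ]
  intro hd
  have hd' : ℓ ∣ 2 ^ 4 * 5 := by exact_mod_cast hd
  rcases (Nat.Prime.dvd_mul hℓ.out).mp hd' with h | h
  · exact h2 ((Nat.prime_dvd_prime_iff_eq hℓ.out Nat.prime_two).mp (hℓ.out.dvd_of_dvd_pow h))
  · exact h5 ((Nat.prime_dvd_prime_iff_eq hℓ.out (by norm_num)).mp h)

/-- `20.a3 mod 5 = [0, 1, 0, 4, 0]`. [cite: BurungaleSkinner2023, Example (E2) (p. 22)] -/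
theorem M20a3_mod_five : M20a3.map (Int.castRingHom (ZMod 5)) = ⟨0, 1, 0, 4, 0⟩ := by
  ext <;> decide

/-- A quadratic over `𝔽₅` with no root in `𝔽₅` does not split. [folklore] -/
private theorem not_splits_quadratic_F5 {a b c : ZMod 5} (ha : a ≠ 0)
    (h : ∀ r : ZMod 5, a * r ^ 2 + b * r + c ≠ 0) : ¬ (C a * X ^ 2 + C b * X + C c).Splits := by
  intro hs
  have hdeg : (C a * X ^ 2 + C b * X + C c).degree ≠ 0 := by
    rw [Polynomial.degree_quadratic ha]; decide
  obtain ⟨r, hr⟩ := hs.exists_eval_eq_zero hdeg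
  have hr' : a * r ^ 2 + b * r + c = 0 := by
    simpa [eval_add, eval_mul, eval_pow, eval_C, eval_X] using hr
  exact h r hr'

/-- `c₄`, `b₂`, `b₄`, `b₆` of `20.a3 mod 5`. [folklore] -/
private theorem invariants_mod_five :
    (⟨0, 1, 0, 4, 0⟩ : WeierstrassCurve (ZMod 5)).c₄ = 4 ∧
      (⟨0, 1, 0, 4, 0⟩ : WeierstrassCurve (ZMod 5)).b₂ = 4 ∧
      (⟨0, 1, 0, 4, 0⟩ : WeierstrassCurve (ZMod 5)).b₄ = 3 ∧
      (⟨0, 1, 0, 4, 0⟩ : WeierstrassCurve (ZMod 5)).b₆ = 0 := by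
  refine ⟨by decide, by decide, by decide, by decide⟩

/-- The node-tangent quadratic `4X² + 2` of `20.a3 mod 5` has no root in `𝔽₅` (`2` is not a square
mod `5`). [folklore] -/
private theorem nodeQuadratic_mod_five_ne_zero :
    ∀ r : ZMod 5, 4 * r ^ 2 + 0 * 4 * r + -(54 * 0 - 3 * 4 * 3 + 1 * 4) ≠ 0 := by decide

/-- **"`N = {5}`": `20.a3` is NON-SPLIT multiplicative at `5`** (the node-tangent quadratic
`4X² + 2` is irreducible over `𝔽₅`). [cite: BurungaleSkinner2023, Example (E2) (p. 22) ("N = {5}")] -/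
theorem not_hasSplitMultiplicativeReductionAtPrime_c20a3_five [Fact (Nat.Prime 5)] :
    ¬ c20a3.HasSplitMultiplicativeReductionAtPrime 5 := by
  haveI := isElliptic_c20a3
  haveI := isGloballyMinimal_c20a3
  have hint : integralModelInt c20a3 = M20a3 := integralModelInt_baseChange_int M20a3
  have hΔ : ((5 : ℕ) : ℤ) ∣ (integralModelInt c20a3).Δ := by rw [hint, M20a3_Δ]; decide
  have hc₄ : ¬ ((5 : ℕ) : ℤ) ∣ (integralModelInt c20a3).c₄ := by rw [hint, M20a3_c₄]; decide
  rw [LocalTorsionMult.hasSplitMultiplicativeReductionAtPrime_iff_splits_integralModelInt c20a3 5 hΔ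
    hc₄, hint, M20a3_mod_five]
  obtain ⟨e1, e2, e3, e4⟩ := invariants_mod_five
  dsimp only
  rw [e1, e2, e3, e4, sub_eq_add_neg, ← C_neg]
  exact not_splits_quadratic_F5 (by decide) nodeQuadratic_mod_five_ne_zero

/-- `20.a3` is not additive at any prime `ℓ ≠ 2` (good off `{2,5}`, multiplicative at `5`): the
conditions (d), (e) of Thm. 2.8 are vacuous. [cite: BurungaleSkinner2023, Example (E2) (p. 22) ("A = {2}")] -/
theorem not_addv_c20a3 {ℓ : ℕ} [Fact ℓ.Prime] (h2 : ℓ ≠ 2) : ¬ Addv c20a3 ℓ := by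
  intro hA
  by_cases h5 : ℓ = 5
  · subst h5
    exact hA.2 hasMultiplicativeReductionAtPrime_c20a3_five
  · exact hA.1 (hasGoodReductionAtPrime_c20a3 h2 h5)

/-- The coefficients of `20.a3 / ℚ`. [cite: BurungaleSkinner2023, Example (E2) (p. 22)] -/
theorem c20a3_eq : c20a3 = ⟨0, 1, 0, -1, 0⟩ := by
  ext <;> simp [WeierstrassCurve.baseChange, WeierstrassCurve.map]

/-- **"This curve has a rational `3`-torsion point"**: `T = (1, 1) ∈ E(ℚ)` (`ψ₃(1) = 0`).
[cite: BurungaleSkinner2023, Example (E2) (p. 22)] -/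
def T20a3 : c20a3.toAffine.Point :=
  Affine.Point.some 1 1 ((Affine.nonsingular_iff' _ _).mpr
    ⟨(Affine.equation_iff _ _).mpr (by rw [c20a3_eq]; norm_num), Or.inr (by rw [c20a3_eq]; norm_num)⟩)

/-- `T + T = −T` on `20.a3` (tangent slope `2` at `(1,1)`; `−T = (1,−1)`).
[cite: BurungaleSkinner2023, Example (E2) (p. 22)] -/
theorem T20a3_add_self [DecidableEq ℚ] : T20a3 + T20a3 = -T20a3 := by
  have hy : (1 : ℚ) ≠ c20a3.toAffine.negY 1 1 := by rw [c20a3_eq]; norm_num [Affine.negY]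
  unfold T20a3
  rw [Affine.Point.add_self_of_Y_ne hy, Affine.Point.neg_some]
  congr 1
  · rw [Affine.slope_of_Y_ne rfl hy, c20a3_eq]
    norm_num [Affine.addX, Affine.negY]
  · rw [Affine.slope_of_Y_ne rfl hy, c20a3_eq]
    norm_num [Affine.addY, Affine.negAddY, Affine.addX, Affine.negY]

/-- `3·T̄ = O` in `E(ℚ̄)` for `20.a3`. [cite: BurungaleSkinner2023, Example (E2) (p. 22)] -/
theorem three_nsmul_toGeomPoints_T20a3 : (3 : ℕ) • toGeomPoints c20a3 T20a3 = 0 := by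
  have h3 : ∀ [DecidableEq ℚ], (3 : ℕ) • T20a3 = 0 := fun {_} => by
    rw [show (3 : ℕ) = 2 + 1 from rfl, add_nsmul, two_nsmul, one_nsmul, T20a3_add_self,
      neg_add_cancel]
  have h := map_nsmul (Affine.Point.map (W' := c20a3.toAffine) (S := ℚ)
    (Algebra.ofId ℚ (AlgebraicClosure ℚ))) 3 T20a3
  rw [h3, map_zero] at h
  exact h.symm

end Curve

/-! ### §2 Theorems 2.9, 3.2, 3.5 for `20.a3` (`ℓ₀ = 2 ∈ A`, `2 ≡ −1 (mod 3)`) -/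

section PosProportion

/-- **Thm. 2.9 for `20.a3`**, modulo `thm29_posProportion_twists_rankOne_nondegenerate`: "there
exists a positive proportion of odd quadratic characters `ψ` … the twists `E^ψ` satisfy the conclusion
of Theorem 2.8" — `rank = ord_{s=1} L = 1`, `λ = 1`, NON-DEGENERATE `3`-adic height.
[cite: BurungaleSkinner2023, Example (E2) (p. 22) with Thm. 2.9 (p. 21)] -/
theorem posProportion_twists_c20a3 (h : thm29_posProportion_twists_rankOne_nondegenerate) :
    haveI := isElliptic_c20a3
    haveI := isGloballyMinimal_c20a3
    OddQuadraticCharPosProportion fun d ↦ TwistConclusion c20a3 3 d := by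
  haveI := isElliptic_c20a3
  haveI := isGloballyMinimal_c20a3
  exact posProportion_twists_of_intModel M20a3 (ℓ₀ := 2) (by rw [M20a3_Δ]; decide)
    (by rw [M20a3_Δ]; decide) (by rw [M20a3_Δ]; decide) (by rw [M20a3_Δ]; decide)
    numPrimesAbove_three_two (fun _ => by decide) T20a3 (Affine.Point.some_ne_zero _)
    three_nsmul_toGeomPoints_T20a3 h

/-- **Infinitely many rank-one twists of `20.a3` with non-degenerate `3`-adic height**, modulo Thm.
2.9 by name. [cite: BurungaleSkinner2023, Example (E2) (p. 22) with Thm. 2.9 (p. 21)] -/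
theorem infinitelyMany_twists_c20a3 (h : thm29_posProportion_twists_rankOne_nondegenerate) :
    haveI := isElliptic_c20a3
    haveI := isGloballyMinimal_c20a3
    {d : ℤ | IsOddQuadraticCharDiscr d ∧ TwistConclusion c20a3 3 d}.Infinite :=
  (posProportion_twists_c20a3 h).infinite

/-- **Thm. 3.2 for `20.a3`**, modulo `thm32_posProportion_twists_pPartBSD`.
[cite: BurungaleSkinner2023, Thm. 3.2 (p. 25) with Example (E2) (p. 22)] -/
theorem infinitelyMany_twists_c20a3_pPartBSD (h : thm32_posProportion_twists_pPartBSD) :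
    haveI := isElliptic_c20a3
    haveI := isGloballyMinimal_c20a3
    {d : ℤ | IsOddQuadraticCharDiscr d ∧ ((c20a3.quadraticTwist (d : ℚ)).analyticRank = 1 ∧
      ∀ (W' : WeierstrassCurve ℚ) [W'.IsElliptic] [W'.IsGloballyMinimal] (C : VariableChange ℚ),
        C • c20a3.quadraticTwist (d : ℚ) = W' → PPartRankOnePrintShape W' 3)}.Infinite := by
  haveI := isElliptic_c20a3
  haveI := isGloballyMinimal_c20a3
  exact infinitelyMany_twists_pPartBSD_of_intModel M20a3 (ℓ₀ := 2) (by rw [M20a3_Δ]; decide)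
    (by rw [M20a3_Δ]; decide) (by rw [M20a3_Δ]; decide) (by rw [M20a3_Δ]; decide)
    numPrimesAbove_three_two (fun _ => by decide) T20a3 (Affine.Point.some_ne_zero _)
    three_nsmul_toGeomPoints_T20a3 h

/-- **Thm. 3.5 for `20.a3`**, modulo `thm35_posProportion_evenTwists_pPartBSD_rankZero`.
[cite: BurungaleSkinner2023, Thm. 3.5 (p. 27) with Example (E2) (p. 22)] -/
theorem infinitelyMany_evenTwists_c20a3_pPartBSD_rankZero
    (h : thm35_posProportion_evenTwists_pPartBSD_rankZero) :
    haveI := isElliptic_c20a3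
    haveI := isGloballyMinimal_c20a3
    {d : ℤ | IsEvenQuadraticCharDiscr d ∧ ((c20a3.quadraticTwist (d : ℚ)).entireLFunction 1 ≠ 0 ∧
      ∀ (W' : WeierstrassCurve ℚ) [W'.IsElliptic] [W'.IsGloballyMinimal] (C : VariableChange ℚ),
        C • c20a3.quadraticTwist (d : ℚ) = W' → PPartRankZeroPrintShape W' 3)}.Infinite := by
  haveI := isElliptic_c20a3
  haveI := isGloballyMinimal_c20a3
  exact infinitelyMany_evenTwists_pPartBSD_rankZero_of_intModel M20a3 (ℓ₀ := 2)
    (by rw [M20a3_Δ]; decide) (by rw [M20a3_Δ]; decide) (by rw [M20a3_Δ]; decide)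
    (by rw [M20a3_Δ]; decide) numPrimesAbove_three_two (fun _ => by decide) T20a3
    (Affine.Point.some_ne_zero _) three_nsmul_toGeomPoints_T20a3 h

end PosProportion

/-! ### §3 Theorem 2.8 for `(20.a3, ℓ₀ = 2, ψ = ψ_{ℚ(√−19)})`: the `−19` twist `7220.f3` -/

section NegNineteen

/-- `−19 = d_{ℚ(√−19)}` is the discriminant of an imaginary quadratic field. [cite: Cox2013, §5.B] -/
theorem isOddQuadraticCharDiscr_neg_nineteen : IsOddQuadraticCharDiscr (-19) := by
  refine isOddQuadraticCharDiscr_iff.mpr ⟨Or.inl ⟨by decide, ?_, by decide⟩, by norm_num⟩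
  rw [← Int.squarefree_natAbs]
  exact (show Nat.Prime 19 by norm_num).prime.squarefree

/-- **All hypotheses of Thm. 2.8 for `(20.a3, Φ = ⟨T̄⟩, ℓ₀ = 2, K = K' = an imaginary quadratic field
of discriminant −19)`** — the printed conditions "`ψ(2) = ±1`, `ψ(5) = 1` or `ψ` is ramified at `5`,
`ψ(3) = −1`, `3 ∤ h_{K_ψ}`" for `ψ = ψ_{ℚ(√−19)}`: `3 ∤ N` and `2 ∣ N` (support of `Δ = 2⁴·5`);
`ϕ = 1`; `r₂ = 1`; `ℓ₀ = 2 ∈ A` with `2 ≡ −1 (mod 3)`; `3 ∤ 19`; (a) `ψ` unramified at `2` (`2 ∤ 19`;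
`20.a3` is not multiplicative at `2`, so the split/non-split clauses are void); (b) void (`S = ∅`);
(c) `5 ∈ N`, `ψ(5) = +1` (`(−19/5) = 1`); (d), (e) void (no additive prime `≠ ℓ₀`); (f) `ψ(3) = −1`
(`(−19/3) = −1`); (g) `h(−19) = 1`. [cite: BurungaleSkinner2023, Example (E2) (p. 22) with Thm. 2.8 (hypotheses, p. 20)] -/
theorem thm28Hypotheses_c20a3_of_discr_eq_neg_nineteen [Fact (Nat.Prime 5)]
    (K : Type) [Field K] [NumberField K] (hK : IsImaginaryQuadratic K)
    (hd : NumberField.discr K = -19) :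
    haveI := isGloballyMinimal_c20a3
    ∃ Φ : AddSubgroup (geomTorsion c20a3 ((3 : ℕ) : ℤ)), Thm28Hypotheses c20a3 Φ 2 K K := by
  haveI := isElliptic_c20a3
  haveI := isGloballyMinimal_c20a3
  obtain ⟨Φ, hcard, htriv⟩ := exists_line_of_nsmul_toGeomPoints_eq_zero (p := 3) T20a3
    (Affine.Point.some_ne_zero _) three_nsmul_toGeomPoints_T20a3
  have hmult : ∀ (ℓ : ℕ) [Fact ℓ.Prime], ℓ ≠ 2 → ℓ ≠ 5 → ¬ c20a3.HasMultiplicativeReductionAtPrime ℓ :=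
    fun ℓ _ h2 h5 => (hasGoodReductionAtPrime_c20a3 h2 h5).not_hasMultiplicativeReduction
  refine ⟨Φ, ?_⟩
  exact {
    three_not_dvd_conductor := not_dvd_conductorNorm_baseChange_int M20a3 Nat.prime_three
      (by rw [M20a3_Δ]; decide) (by rw [M20a3_Δ]; decide)
    isRationalLine := ⟨hcard, fun σ P hP => by rw [htriv σ P hP]; exact hP⟩
    lineEven := lineEven_of_forall_smul_eq htriv
    lineUnramifiedAt := lineUnramifiedAt_of_forall_smul_eq htriv
    ell0_dvd_conductor := dvd_conductorNorm_baseChange_int M20a3 Nat.prime_two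
      (by rw [M20a3_Δ]; decide) (by rw [M20a3_Δ]; decide)
    numPrimesAbove_ell0 := numPrimesAbove_three_two
    lineUnramifiedAt_ell0 := lineUnramifiedAtPrime_of_forall_smul_eq htriv 2
    ell0_mod_three_of_addv := fun _ => by decide
    isImaginaryQuadratic := hK
    isImaginaryQuadratic' := hK
    isProductCharacterField := isProductCharacterField_self_of_isImaginaryQuadratic htriv K hK
    three_not_dvd_discr := by rw [hd]; decide
    lineUnramifiedAt_of_dvd_discr := fun ℓ _ _ => lineUnramifiedAtPrime_of_forall_smul_eq htriv ℓ
    a_split := fun hs =>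
      absurd hs.hasMultiplicativeReductionAtPrime not_hasMultiplicativeReductionAtPrime_c20a3_two
    a_nonsplit := fun hm _ => absurd hm not_hasMultiplicativeReductionAtPrime_c20a3_two
    a_addv := fun _ => by rw [hd]; decide
    b := by
      intro ℓ _ h2 hs
      by_cases h5 : ℓ = 5
      · subst h5
        exact absurd hs not_hasSplitMultiplicativeReductionAtPrime_c20a3_five
      · exact absurd hs.hasMultiplicativeReductionAtPrime (hmult ℓ h2 h5)
    c := by
      intro ℓ _ h2 hm _
      by_cases h5 : ℓ = 5
      · subst h5
        exact Or.inr (satisfiesHeegnerHypothesis_prime_of_jacobiSym_eq_one hK.1 (by norm_num)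
          (by norm_num) (by rw [hd]; norm_num))
      · exact absurd hm (hmult ℓ h2 h5)
    d := fun ℓ _ h2 hA _ _ => absurd hA (not_addv_c20a3 h2)
    e := fun ℓ _ h2 hA _ _ => absurd hA (not_addv_c20a3 h2)
    f := isInertIn_of_legendreSym_eq_neg_one hK.1 (by rw [hd]; norm_num)
    g := by rw [classNumber_eq_one_of_discr_mem hK.1 (by rw [hd]; decide)]; decide }

/-- **"In particular, they hold for the `−19`-twist of `E` (the curve 7220.f3)"**, modulo Thm. 2.8
by name: granting `thm28_twist_rankOne_nondegenerate`, `rank E^{(−19)}(ℚ) = ord_{s=1} L(E^{(−19)}, s)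
= 1`, `λ(L_{E^{(−19)}}) = 1`, and the `3`-adic height pairing on every global minimal model of
`E^{(−19)}`, `E = 20.a3`, is NON-DEGENERATE — every hypothesis kernel-checked (so `Thm28Hypotheses`
is inhabited with `ℓ₀ ∈ A`). [cite: BurungaleSkinner2023, Example (E2) (p. 22)] -/
theorem twistConclusion_c20a3_neg_nineteen [Fact (Nat.Prime 5)]
    (h : thm28_twist_rankOne_nondegenerate) :
    haveI := isElliptic_c20a3
    haveI := isGloballyMinimal_c20a3
    TwistConclusion c20a3 3 (-19) := by
  haveI := isElliptic_c20a3
  haveI := isGloballyMinimal_c20a3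
  obtain ⟨K, _, _, hK, hd⟩ := isOddQuadraticCharDiscr_neg_nineteen
  obtain ⟨Φ, hΦ⟩ := thm28Hypotheses_c20a3_of_discr_eq_neg_nineteen K hK hd
  have hc := h c20a3 Φ 2 K K hΦ
  rwa [hd] at hc

/-- **The `3`-adic height on the `−19` twist of `20.a3` is non-degenerate** (on every global minimal
model `W'` of `E^{(−19)}`, for the canonical height datum), modulo Thm. 2.8 by name — the I1-relevant
clause of `twistConclusion_c20a3_neg_nineteen` read out. [cite: BurungaleSkinner2023, Example (E2) (p. 22) with Thm. 2.8 (second bullet, p. 20)] -/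
theorem padicHeightNondegenerate_twist_c20a3_neg_nineteen [Fact (Nat.Prime 5)]
    (h : thm28_twist_rankOne_nondegenerate) (W' : WeierstrassCurve ℚ) [W'.IsElliptic]
    [W'.IsGloballyMinimal] (C : VariableChange ℚ)
    (hW' : haveI := isElliptic_c20a3; C • c20a3.quadraticTwist ((-19 : ℤ) : ℚ) = W') :
    PAdicHeightNondegenerate W' 3 := by
  haveI := isElliptic_c20a3
  haveI := isGloballyMinimal_c20a3
  exact ((twistConclusion_c20a3_neg_nineteen h).2.2 W' C hW').2

/-- **The `3`-part of BSD for the `−19` twist of `20.a3`, modulo Thm. 3.1 by name.**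
[cite: BurungaleSkinner2023, Thm. 3.1 (p. 25) with Example (E2) (p. 22)] -/
theorem pPartBSD_twist_c20a3_neg_nineteen [Fact (Nat.Prime 5)] (h : thm31_twist_pPartBSD_rankOne) :
    haveI := isElliptic_c20a3
    (c20a3.quadraticTwist ((-19 : ℤ) : ℚ)).analyticRank = 1 ∧
      ∀ (W' : WeierstrassCurve ℚ) [W'.IsElliptic] [W'.IsGloballyMinimal] (C : VariableChange ℚ),
        C • c20a3.quadraticTwist ((-19 : ℤ) : ℚ) = W' → PPartRankOnePrintShape W' 3 := by
  haveI := isElliptic_c20a3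
  haveI := isGloballyMinimal_c20a3
  obtain ⟨K, _, _, hK, hd⟩ := isOddQuadraticCharDiscr_neg_nineteen
  obtain ⟨Φ, hΦ⟩ := thm28Hypotheses_c20a3_of_discr_eq_neg_nineteen K hK hd
  have hc := h c20a3 3 2 K K (Or.inl ⟨rfl, Φ, hΦ⟩)
  rwa [hd] at hc

end NegNineteen

end Literature.NumberTheory.EllipticCurves.BurungaleSkinner2023

end
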